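import Summits.BirchSwinnertonDyer.BirchSwinnertonDyer.Theorems.KolyvaginRankRigidityAtTwoKolyvaginSwapAssembly
import Summits.BirchSwinnertonDyer.BirchSwinnertonDyer.Theorems.KolyvaginRankRigidityAtTwoShedSeedPrimeShapedAtTwo
import HarnessLib

/-!
# Crux U1 `KolyvaginBoundedDefectAtTwo` (stmt-BirchSwinnertonDyer-28083), LINE 17 `kolyvagin_swap` — THE COMPOSITION, PLUGGED:
# U1 ⟸ S0ʳ (Kolyvagin's conjecture at 2 in room form, the line's INPUT) + Gross 1991 Prop. 3.7 (2) (the line's one PRINT fact)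

Width seat `bsd-line-krr2-p2` g19 (ONE READER on LINE 17); `--supports stmt-BirchSwinnertonDyer-28083` (helper).  One line: the composition
`KolyvaginSwap.kolyvaginBoundedDefectAtTwo_of_roomSeed_of_shedSeed` (`…KolyvaginSwapAssembly`: vertical growth ∘ the shaped walk ∘ the cut,
pen bsd-idea-1 v8.5 kernel verbatim) with SWα⁗ supplied by the tree theorem `KolyvaginSwap.shedSeedPrimeShapedAtTwo_of_frobeniusCongruence`
(`…ShedSeedPrimeShapedAtTwo`, p738438).  HONEST FRAMING: CONDITIONAL on the OPEN input S0ʳ (`KolyvaginSwap.KolyvaginRoomSeedAtTwo`,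
`@[conjecture]`) and the named print fact P372 (`GrossLMS1991.prop37_2_frobeniusCongruence`, unproved in the tree: Eichler–Shimura wall); the
crux item is NOT closed; no rung; **BSD is NOT proved.**  What it records: LINE 17's swap machinery reduces U1 to exactly {S0ʳ, P372} in
the kernel.
References (locators only): [cite: Kolyvagin1991MathAnn, §2 (2.1), Conj. 2.5] [cite: GrossLMS1991, §3 Prop. 3.7 (2), §9].
Design: no definitions; axioms `propext`, `Classical.choice`, `Quot.sound`.
-/

set_option autoImplicit false
-- the Theorems namespace of this sub repeats the summit name by design (D-0017 nested layout)
set_option linter.dupNamespace false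

namespace Summit.BirchSwinnertonDyer.BirchSwinnertonDyer.Theorems.KolyvaginAtTwo.KolyvaginSwap

open Summit.BirchSwinnertonDyer.BirchSwinnertonDyer.Theses.KolyvaginRankRigidityAtTwo

/-- **U1 ⟸ S0ʳ + P372 (LINE 17 `kolyvagin_swap`).**  CONDITIONAL: `hS` is Kolyvagin's conjecture at 2 in room form (the line's input,
`@[conjecture]`), `h37` is Gross 1991 Prop. 3.7 (2) (named Literature fact); see the module docstring.  Closes nothing; BSD is not proved.
[cite: Kolyvagin1991MathAnn, §2 (2.1), Conj. 2.5] [cite: GrossLMS1991, §3 Prop. 3.7 (2), §9] -/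
theorem kolyvaginBoundedDefectAtTwo_of_roomSeed_of_frobeniusCongruence (hS : KolyvaginRoomSeedAtTwo)
    (h37 : Literature.NumberTheory.EllipticCurves.GrossLMS1991.prop37_2_frobeniusCongruence) : KolyvaginBoundedDefectAtTwo :=
  kolyvaginBoundedDefectAtTwo_of_roomSeed_of_shedSeed hS (shedSeedPrimeShapedAtTwo_of_frobeniusCongruence h37) h37

end Summit.BirchSwinnertonDyer.BirchSwinnertonDyer.Theorems.KolyvaginAtTwo.KolyvaginSwap
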